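import Summits.CriticalPhenomena.PercolationContinuityZ3.Theorems.Transplant.CayleyZ2DihSkewBilayer
import HarnessLib

/-!
# The skew bilayer `X = Cay(ℤ² ⋊ C₂; τ₀, τ₁, τ₀σ, τ₁σ)` IS VERTEX-TRANSITIVE: the sheet swap — kernel form of the refuter's erratum (E3) on customer (c3)

builds on p205010 (kernel theorem, internal audit signed; external expert review pending) — nothing in this file uses p205010; nothing here is a claim about
any open node.  Lane `prim-bschramm`, seat `prim-hp-8` gen 58.  Helper file (`--supports stmt-CriticalPhenomena-4575 --as helper`).

ERRATUM (WORDS) to «CayleyZ2DihSkewBilayer» (p494157), located by the refuter p5 gen 27 (bus 2026-08-27 #5872 (E3)).  That file's header is correct about the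
PRESENTATION — `b₁(ℤ² ⋊ C₂) = 0`, so no chart on `X` is translated by a vertex-transitive group of LEFT TRANSLATIONS OF `Γ = ℤ² ⋊ C₂` — but `X` has more
automorphisms than `Γ`: the SHEET SWAP `α(v, 0) = (v + e₀, 1)`, `α(v, 1) = (v − e₁, 0)` is an automorphism of `X` (`swapIso`) with `α² =` translation by
`e₀ − e₁` (`swapFun_swapFun`), it commutes with the translations, `⟨translations, α⟩ ≅ ℤ²` acts simply transitively, and
`X = Cay(ℤ²; ±f, ±g, ±(2f + g))` (`f = α`, `g = τ₁`, `τ₀ = 2f + g`) — the square lattice with the `(2,1)`-bonds, whose `θ(p_c) = 0` was ALREADY a theorem of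
the tree (every finite generating set of `ℤ^d`).  Hence «CayleyZ2DihSkewBilayer» is a REGRESSION instance of the orbit theorem (a second, independent route to
a known customer), NOT a new reach, and nothing in it may be read as 'outside every one-type node'.  The genuinely multi-type customer of P3-NILPOTENT §20.2
is (c4) «Z2PeriodicBilayerNonTransitive» (degrees `5/7`: not vertex-transitive — kernel `Z2BilayerNE.not_vertexTransitive`).  This file makes the located
fact kernel: **`Z2DihSkew.vertexTransitive : ∀ a b, ∃ γ : X ≃g X, γ a = b`.**
[cite: BenjaminiSchramm1996, §2 (Cayley graphs)] [this work]
-/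

noncomputable section

namespace Summit.CriticalPhenomena.PercolationContinuityZ3.Theorems.Transplant

open MeasureTheory Literature.Probability.Percolation Literature.Probability.LatticeModels SimpleGraph
open scoped Classical

namespace Z2DihSkew

/-! ## The sheet swap `α` -/

/-- The sheet swap as a map: `(v, 0) ↦ (v + e₀, 1)`, `(v, 1) ↦ (v − e₁, 0)`. [this work] -/
def swapFun (a : Vtx) : Vtx := if a.2 = 0 then (a.1 + e 0, 1) else (a.1 - e 1, 0)

/-- Its inverse: `(w, 0) ↦ (w + e₁, 1)`, `(w, 1) ↦ (w − e₀, 0)`. [this work] -/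
def swapInv (a : Vtx) : Vtx := if a.2 = 0 then (a.1 + e 1, 1) else (a.1 - e 0, 0)

/-- `α (v, 0) = (v + e₀, 1)`. [this work] -/
@[simp] theorem swapFun_zero (v : Site 2) : swapFun (v, 0) = (v + e 0, 1) := by simp [swapFun]

/-- `α (v, 1) = (v − e₁, 0)`. [this work] -/
@[simp] theorem swapFun_one (v : Site 2) : swapFun (v, 1) = (v - e 1, 0) := by simp [swapFun]

/-- `α⁻¹ (w, 0) = (w + e₁, 1)`. [this work] -/
@[simp] theorem swapInv_zero (w : Site 2) : swapInv (w, 0) = (w + e 1, 1) := by simp [swapInv]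

/-- `α⁻¹ (w, 1) = (w − e₀, 0)`. [this work] -/
@[simp] theorem swapInv_one (w : Site 2) : swapInv (w, 1) = (w - e 0, 0) := by simp [swapInv]

/-- `α⁻¹ ∘ α = id`. [this work] -/
theorem swapInv_swapFun (a : Vtx) : swapInv (swapFun a) = a := by
  obtain ⟨v, j⟩ := a
  rcases fin_two_eq_zero_or_one j with rfl | rfl <;> simp

/-- `α ∘ α⁻¹ = id`. [this work] -/
theorem swapFun_swapInv (a : Vtx) : swapFun (swapInv a) = a := by
  obtain ⟨v, j⟩ := a
  rcases fin_two_eq_zero_or_one j with rfl | rfl <;> simp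

/-- **`α² = ` the translation by `e₀ − e₁`.** [this work] -/
theorem swapFun_swapFun (a : Vtx) : swapFun (swapFun a) = (a.1 + (e 0 - e 1), a.2) := by
  obtain ⟨v, j⟩ := a
  rcases fin_two_eq_zero_or_one j with rfl | rfl
  · simp [add_sub_assoc]
  · simp only [swapFun_one, swapFun_zero]
    rw [sub_add_eq_add_sub, add_sub_assoc]

/-- `α` commutes with the translations. [this work] -/
theorem swapFun_shift (u : Site 2) (a : Vtx) : swapFun (a.1 + u, a.2) = ((swapFun a).1 + u, (swapFun a).2) := by
  obtain ⟨v, j⟩ := a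
  rcases fin_two_eq_zero_or_one j with rfl | rfl
  · simp [add_right_comm]
  · simp [sub_add_eq_add_sub]

/-- **`α` preserves adjacency** (twelve bonds checked). [this work] -/
theorem adj_swapFun {a b : Vtx} (h : graph.Adj a b) : graph.Adj (swapFun a) (swapFun b) := by
  have hb := mem_nbrs_of_adj h
  simp only [nbrs, Finset.mem_insert, Finset.mem_singleton] at hb
  obtain ⟨v, j⟩ := a
  rcases fin_two_eq_zero_or_one j with rfl | rfl
  · rcases hb with rfl | rfl | rfl | rfl | rfl | rfl <;> simp [sgn]
    · exact adj_axis _ 1 0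
    · rw [add_right_comm]; exact adj_axis _ 1 1
    · have := adj_axis' (v + e 0) 1 0
      rwa [add_sub_cancel_right] at this
    · rw [sub_add_eq_add_sub]; exact adj_axis' _ 1 1
    · exact adj_rung' _ 1
    · have := adj_rung' (v + e 0) 0
      rwa [add_sub_cancel_right] at this
  · rcases hb with rfl | rfl | rfl | rfl | rfl | rfl <;> simp [sgn]
    · rw [← sub_add_eq_add_sub]; exact adj_axis _ 0 0
    · have := adj_axis (v - e 1) 0 1
      rwa [sub_add_cancel] at this
    · rw [sub_right_comm]; exact adj_axis' _ 0 0
    · exact adj_axis' _ 0 1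
    · have := adj_rung (v - e 1) 1
      rwa [sub_add_cancel] at this
    · rw [← sub_eq_add_neg]
      exact adj_rung _ 0

/-- **The sheet swap is an automorphism of `X`.** [this work] -/
def swapIso : graph ≃g graph where
  toEquiv := ⟨swapFun, swapInv, swapInv_swapFun, swapFun_swapInv⟩
  map_rel_iff' := by
    intro a b
    refine ⟨fun h => ?_, adj_swapFun⟩
    have h2 := adj_swapFun h
    change graph.Adj (swapFun (swapFun a)) (swapFun (swapFun b)) at h2
    rw [swapFun_swapFun, swapFun_swapFun] at h2
    have h3 := adj_shift (-(e 0 - e 1)) h2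
    dsimp only at h3
    rwa [add_neg_cancel_right, add_neg_cancel_right] at h3

/-- `swapIso a = swapFun a`. [this work] -/
@[simp] theorem swapIso_apply (a : Vtx) : swapIso a = swapFun a := rfl

/-- The sheet swap exchanges the sheets. [this work] -/
theorem swapFun_snd_ne (a : Vtx) : (swapFun a).2 ≠ a.2 := by
  obtain ⟨v, j⟩ := a
  rcases fin_two_eq_zero_or_one j with rfl | rfl <;> simp

/-- **`X` IS VERTEX-TRANSITIVE** (translations inside a sheet, the sheet swap across): so «CayleyZ2DihSkewBilayer» is a regression instance of the orbit
theorem, not a graph outside the one-type nodes (p5-g27's erratum (E3), kernel form). [this work] -/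
theorem vertexTransitive (a b : Vtx) : ∃ γ : graph ≃g graph, γ a = b := by
  by_cases h : a.2 = b.2
  · exact ⟨shiftIso (b.1 - a.1), Prod.ext (by simp) (by simpa using h)⟩
  · refine ⟨swapIso.trans (shiftIso (b.1 - (swapFun a).1)), ?_⟩
    show shiftIso (b.1 - (swapFun a).1) (swapIso a) = b
    rw [swapIso_apply, shiftIso_apply]
    refine Prod.ext (by simp) ?_
    dsimp only
    have hs := swapFun_snd_ne a
    rcases fin_two_eq_zero_or_one (swapFun a).2 with h1 | h1 <;> rcases fin_two_eq_zero_or_one a.2 with h2 | h2 <;>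
      rcases fin_two_eq_zero_or_one b.2 with h3 | h3 <;> simp_all

end Z2DihSkew

end Summit.CriticalPhenomena.PercolationContinuityZ3.Theorems.Transplant

end
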